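import Mathlib
import Literature.Algebra.Polynomial.ModularEEA
import Literature.Algebra.Polynomial.ModularGcd
import HarnessLib

/-!
# Route GaugeDescent — `DescentGlue` (stmt-ValiantsHypothesis-6637), part D: integrality of the
# descended point away from an explicit integer `M`

Bürgisser's small solution (TCS 2000 Thm. 4.5) has coordinates `z_w = λ⁻¹ v_w(θ)` with
`g(θ) = 0` for a primitive irreducible `g ∈ ℤ[Y]` and `v_w ∈ ℤ[Y]`. The descended point of part C
is `y_a = ∏_w z_w^{B a w}` (integer exponents, supported on the support of `z`). Here we show that
every `y_a` is INTEGRAL OVER `ℤ[1/M]` for the explicit positive integer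
`M = |lc g| · λ · ∏_w max(1, |Res(g, v_w)|)`:
`∃ e, M^e · y_a` is an algebraic integer (`exists_integral_denominator`). Ingredients:
`|lc g| · θ` is integral; `c^{deg P} P(θ) ∈ ℤ[cθ]` (`scaleRoots`); the Bézout identity
`s g + t v_w = Res(g, v_w)` over `ℤ` (the tree's `ModularEEA.sigmaR_zero`) inverts `v_w(θ)` up to
the integer `Res(g, v_w)`, which is non-zero when `v_w(θ) ≠ 0` (`ModularGcd.resultant_ne_zero_of_isGCD`,
`g` irreducible and primitive).

Honest framing: glue inside a conditional route; `VP ≠ VNP` is NOT proved.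
-/

set_option linter.dupNamespace false

noncomputable section

namespace Summit.ValiantsHypothesis.ValiantsHypothesis.Theorems.GaugeDescent

open Polynomial Finset
open Literature.Algebra.Polynomial

namespace DescentGlue

/-! ### §1. Integrality lemmas -/

/-- A polynomial expression with integer coefficients in an algebraic integer is an algebraic
integer. [folklore] -/
theorem isIntegral_aeval_of_isIntegral {x : ℂ} (hx : IsIntegral ℤ x) (P : ℤ[X]) :
    IsIntegral ℤ (aeval x P) := by
  rw [aeval_eq_sum_range]
  exact IsIntegral.sum _ fun i _ => (hx.pow i).smul _

/-- `c^{deg P} · P(θ)` is an algebraic integer when `c θ` is (`scaleRoots`). [folklore] -/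
theorem isIntegral_pow_natDegree_mul_aeval {θ : ℂ} {c : ℤ} (h : IsIntegral ℤ ((c : ℂ) * θ))
    (P : ℤ[X]) : IsIntegral ℤ ((c : ℂ) ^ P.natDegree * aeval θ P) := by
  have key := scaleRoots_eval₂_mul (p := P) (algebraMap ℤ ℂ) θ c
  rw [algebraMap_int_eq, eq_intCast] at key
  rw [aeval_def, algebraMap_int_eq, ← key, ← algebraMap_int_eq, ← aeval_def]
  exact isIntegral_aeval_of_isIntegral h _

/-- Integer powers: if `M^{e₁} z` and `M^{e₂} z⁻¹` are algebraic integers then so is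
`M^{(e₁+e₂)|b|} z^b` for every `b ∈ ℤ`. [folklore] -/
theorem isIntegral_pow_mul_zpow {M : ℕ} {z : ℂ} {e₁ e₂ : ℕ}
    (h₁ : IsIntegral ℤ ((M : ℂ) ^ e₁ * z)) (h₂ : IsIntegral ℤ ((M : ℂ) ^ e₂ * z⁻¹)) (b : ℤ) :
    IsIntegral ℤ ((M : ℂ) ^ ((e₁ + e₂) * b.natAbs) * z ^ b) := by
  have hM : IsIntegral ℤ ((M : ℂ)) := by
    simpa using (isIntegral_algebraMap (R := ℤ) (A := ℂ) (x := (M : ℤ)))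
  rcases Int.natAbs_eq b with hb | hb
  · -- `b = n ≥ 0`
    set n := b.natAbs
    rw [hb, zpow_natCast]
    have : (M : ℂ) ^ ((e₁ + e₂) * n) * z ^ n = ((M : ℂ) ^ e₂) ^ n * ((M : ℂ) ^ e₁ * z) ^ n := by
      rw [mul_pow, ← pow_mul, ← pow_mul, ← mul_assoc, ← pow_add]
      congr 1; ring_nf
    rw [this]
    exact ((hM.pow _).pow _).mul (h₁.pow _)
  · -- `b = -n`
    set n := b.natAbs
    rw [hb, zpow_neg, zpow_natCast, ← inv_pow]
    have : (M : ℂ) ^ ((e₁ + e₂) * n) * z⁻¹ ^ n = ((M : ℂ) ^ e₁) ^ n * ((M : ℂ) ^ e₂ * z⁻¹) ^ n := by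
      rw [mul_pow, ← pow_mul, ← pow_mul, ← mul_assoc, ← pow_add]
      congr 1; ring_nf
    rw [this]
    exact ((hM.pow _).pow _).mul (h₂.pow _)

/-- Products: a common power of `M` clears a finite product. [folklore] -/
theorem exists_isIntegral_pow_mul_prod {ι : Type} [Fintype ι] {M : ℕ} (f : ι → ℂ)
    (h : ∀ i, ∃ e : ℕ, IsIntegral ℤ ((M : ℂ) ^ e * f i)) :
    ∃ e : ℕ, IsIntegral ℤ ((M : ℂ) ^ e * ∏ i, f i) := by
  classical
  choose e he using h
  refine ⟨∑ i, e i, ?_⟩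
  rw [← prod_pow_eq_pow_sum, ← prod_mul_distrib]
  exact IsIntegral.prod _ fun i _ => he i

/-- Integers are algebraic integers. [folklore] -/
theorem isIntegral_intCast (k : ℤ) : IsIntegral ℤ ((k : ℂ)) := by
  simpa using (isIntegral_algebraMap (R := ℤ) (A := ℂ) (x := k))

/-! ### §2. Bézout at `θ` and non-vanishing of the resultant -/

/-- **Bézout at a root**: `t(θ) · v(θ) = Res(g, v)` where `s g + t v = Res(g, v)` is the
integer Bézout identity of the tree (`ModularEEA.sigmaR_zero`) and `g(θ) = 0`.
[cite: GathenGerhard1999, Theorem 6.52 / Corollary 6.21] -/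
theorem aeval_sigmaT_mul_aeval {g : ℤ[X]} (hg : 0 < g.natDegree) (v : ℤ[X]) {θ : ℂ}
    (hθ : aeval θ g = 0) :
    aeval θ (ModularEEA.sigmaT g v 0) * aeval θ v = ((resultant g v : ℤ) : ℂ) := by
  have h := ModularEEA.sigmaR_zero (f := g) (g := v) hg
  unfold ModularEEA.sigmaR at h
  have := congrArg (aeval θ) h
  rw [map_add, map_mul, map_mul, hθ, mul_zero, zero_add, aeval_C, algebraMap_int_eq,
    eq_intCast] at this
  exact this

/-- **The resultant with the minimal polynomial does not vanish** unless the polynomial vanishes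
at the root: `g` irreducible in `ℤ[Y]` with `g(θ) = 0` and `v(θ) ≠ 0` give `Res(g, v) ≠ 0`.
[cite: GathenGerhard1999, Corollary 6.20] -/
theorem resultant_ne_zero_of_aeval_ne_zero {g v : ℤ[X]} (hirr : Irreducible g)
    {θ : ℂ} (hθ : aeval θ g = 0) (hv : aeval θ v ≠ 0) :
    resultant g v ≠ 0 := by
  refine ModularGcd.resultant_ne_zero_of_isGCD (h := 1) hirr.ne_zero (one_mul g).symm
    (one_mul v).symm fun d hdg hdv => ?_
  rcases (hirr.dvd_iff.mp hdg) with hu | hassoc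
  · exact hu.dvd
  · exfalso
    have hgv : g ∣ v := hassoc.dvd.trans hdv
    obtain ⟨q, hq⟩ := hgv
    apply hv
    rw [hq, map_mul, hθ, zero_mul]

/-! ### §3. The denominator `M` -/

/-- The explicit denominator `M = |lc g| · λ · ∏_w max(1, |Res(g, v_w)|)` is positive.
[folklore] -/
theorem den_pos {μ : ℕ} {lam : ℕ} (hlam : 0 < lam) (v : Fin μ → ℤ[X]) {g : ℤ[X]} (hg : g ≠ 0) :
    0 < g.leadingCoeff.natAbs * lam * ∏ w, max 1 (resultant g (v w)).natAbs := by
  refine Nat.mul_pos (Nat.mul_pos ?_ hlam) (prod_pos fun w _ => ?_)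
  · exact Int.natAbs_pos.mpr (leadingCoeff_ne_zero.mpr hg)
  · exact lt_of_lt_of_le Nat.one_pos (le_max_left _ _)

/-- **Integrality of the descended point away from `M`.** With `z_w = λ⁻¹ v_w(θ)`
(`g(θ) = 0`, `g ∈ ℤ[Y]` irreducible of positive degree, `λ ≥ 1`) and `y_a = ∏_w z_w^{B a w}` on the
support of `z` (`B a w = 0` where `z_w = 0`; `y_a = 0` where `z_a = 0`): for
`M = |lc g| · λ · ∏_w max(1, |Res(g, v_w)|)` every `y_a` satisfies `∃ e, M^e y_a` integral over
`ℤ`. [cite: Burgisser2000TCS, Thm. 4.5 and Rem. 4.6] -/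
theorem exists_integral_denominator {μ : ℕ} {lam : ℕ} (hlam : 0 < lam) (v : Fin μ → ℤ[X])
    {g : ℤ[X]} (hirr : Irreducible g) (hdeg : 0 < g.natDegree) {θ : ℂ}
    (hθ : aeval θ g = 0) (B : Fin μ → Fin μ → ℤ) (y : Fin μ → ℂ)
    (hB0 : ∀ a w, (lam : ℂ)⁻¹ * aeval θ (v w) = 0 → B a w = 0)
    (hy0 : ∀ a, (lam : ℂ)⁻¹ * aeval θ (v a) = 0 → y a = 0)
    (hy : ∀ a, (lam : ℂ)⁻¹ * aeval θ (v a) ≠ 0 →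
      y a = ∏ w, ((lam : ℂ)⁻¹ * aeval θ (v w)) ^ B a w) :
    ∀ a, ∃ e : ℕ, IsIntegral ℤ
      (((g.leadingCoeff.natAbs * lam * ∏ w, max 1 (resultant g (v w)).natAbs : ℕ) : ℂ) ^ e *
        y a) := by
  classical
  -- notation
  set c : ℕ := g.leadingCoeff.natAbs with hc
  set R : ℕ := ∏ w, max 1 (resultant g (v w)).natAbs with hR
  set M : ℕ := c * lam * R with hM
  have hc0 : 0 < c := Int.natAbs_pos.mpr (leadingCoeff_ne_zero.mpr hirr.ne_zero)
  have hR0 : 0 < R := prod_pos fun w _ => lt_of_lt_of_le Nat.one_pos (le_max_left _ _)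
  have hlamC : (lam : ℂ) ≠ 0 := by exact_mod_cast hlam.ne'
  -- `c θ` is integral
  have hcθ : IsIntegral ℤ (((c : ℤ) : ℂ) * θ) := by
    have h1 : IsIntegral ℤ ((g.leadingCoeff : ℂ) * θ) := by
      have := isIntegral_leadingCoeff_smul (R := ℤ) (p := g) (x := θ) hθ
      rwa [Algebra.smul_def, algebraMap_int_eq, eq_intCast] at this
    rcases Int.natAbs_eq g.leadingCoeff with h | h
    · rw [hc, ← h]
      exact h1
    · rw [h, Int.cast_neg, neg_mul] at h1
      rw [hc]
      simpa using h1.neg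
  -- non-vanishing resultants on the support
  have hvθ : ∀ w, (lam : ℂ)⁻¹ * aeval θ (v w) ≠ 0 → aeval θ (v w) ≠ 0 := fun w hw h0 =>
    hw (by rw [h0, mul_zero])
  have hres : ∀ w, (lam : ℂ)⁻¹ * aeval θ (v w) ≠ 0 → resultant g (v w) ≠ 0 := fun w hw =>
    resultant_ne_zero_of_aeval_ne_zero hirr hθ (hvθ w hw)
  -- (i) `M^{deg v_w + 1} z_w` is integral
  have hint1 : ∀ w, IsIntegral ℤ
      ((M : ℂ) ^ ((v w).natDegree + 1) * ((lam : ℂ)⁻¹ * aeval θ (v w))) := by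
    intro w
    have hP := isIntegral_pow_natDegree_mul_aeval hcθ (v w)
    have heq : (M : ℂ) ^ ((v w).natDegree + 1) * ((lam : ℂ)⁻¹ * aeval θ (v w)) =
        (((c * R * (lam * R) ^ (v w).natDegree : ℕ) : ℤ) : ℂ) *
          ((((c : ℤ)) : ℂ) ^ (v w).natDegree * aeval θ (v w)) := by
      rw [hM]
      push_cast
      field_simp
      ring
    rw [heq]
    exact (isIntegral_intCast _).mul hP
  -- (ii) `M^{deg t_w + 1} z_w⁻¹` is integral on the support, `t_w` the Bézout cofactor
  have hint2 : ∀ w, (lam : ℂ)⁻¹ * aeval θ (v w) ≠ 0 →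
      IsIntegral ℤ ((M : ℂ) ^ ((ModularEEA.sigmaT g (v w) 0).natDegree + 1) *
        ((lam : ℂ)⁻¹ * aeval θ (v w))⁻¹) := by
    intro w hw
    set t := ModularEEA.sigmaT g (v w) 0 with ht
    have hRes : resultant g (v w) ≠ 0 := hres w hw
    have hbez : aeval θ t * aeval θ (v w) = ((resultant g (v w) : ℤ) : ℂ) :=
      aeval_sigmaT_mul_aeval hdeg (v w) hθ
    have hP := isIntegral_pow_natDegree_mul_aeval hcθ t
    -- `Res(g, v_w) ∣ R`
    obtain ⟨k, hk⟩ : (resultant g (v w)).natAbs ∣ R := by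
      have h1 : max 1 (resultant g (v w)).natAbs = (resultant g (v w)).natAbs :=
        max_eq_right (Int.natAbs_pos.mpr hRes)
      rw [hR, ← h1]
      exact Finset.dvd_prod_of_mem _ (mem_univ w)
    have hRZ : ((R : ℕ) : ℂ) = ((resultant g (v w) : ℤ) : ℂ) *
        (((Int.sign (resultant g (v w)) * k : ℤ)) : ℂ) := by
      have h2 : ((R : ℕ) : ℤ) = resultant g (v w) * (Int.sign (resultant g (v w)) * k) := by
        rw [hk, Nat.cast_mul, ← Int.sign_mul_self_eq_natAbs]
        ring
      exact_mod_cast h2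
    have htθ : aeval θ (v w) ≠ 0 := hvθ w hw
    have heq : (M : ℂ) ^ (t.natDegree + 1) * ((lam : ℂ)⁻¹ * aeval θ (v w))⁻¹ =
        (((c * lam ^ (t.natDegree + 2) * R ^ t.natDegree : ℕ) : ℤ) *
            (Int.sign (resultant g (v w)) * k) : ℤ) *
          ((((c : ℤ)) : ℂ) ^ t.natDegree * aeval θ t) := by
      rw [hM, mul_inv, inv_inv]
      push_cast
      rw [hRZ, ← hbez]
      push_cast
      field_simp
      ring
    rw [heq]
    exact (isIntegral_intCast _).mul hP
  -- (iii) assembly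
  intro a
  by_cases ha : (lam : ℂ)⁻¹ * aeval θ (v a) = 0
  · exact ⟨0, by rw [hy0 a ha, mul_zero]; exact isIntegral_zero⟩
  · rw [hy a ha]
    refine exists_isIntegral_pow_mul_prod _ fun w => ?_
    by_cases hw : (lam : ℂ)⁻¹ * aeval θ (v w) = 0
    · refine ⟨0, ?_⟩
      rw [hB0 a w hw, zpow_zero, pow_zero, mul_one]
      exact isIntegral_one
    · exact ⟨_, isIntegral_pow_mul_zpow (hint1 w) (hint2 w hw) (B a w)⟩

end DescentGlue

end Summit.ValiantsHypothesis.ValiantsHypothesis.Theorems.GaugeDescent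

end
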